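import Literature.Probability.RandomPlanarGeometry.BDGS2012GrahamLongCount
import Literature.Barriers.CriticalPhenomena.GaussianDominationRouteRandomWalk
import HarnessLib

/-!
# Graham's Borel-type bound for `z_c(d)` (BDGS 2012, (1.20)), XI: the convolution powers
# `H_z^{*n}` and their Fourier bound

Sibling file of `Literature.Probability.RandomPlanarGeometry.BDGS2012` (fact
`BDGS2012_Graham_criticalPoint_bound` = Graham 2010, Theorem 1), sequel to
`BDGS2012GrahamLongCount.lean`. The long pieces of a lace graph are controlled through the marking
inequality `C(k-1,p) c_k(x) ≤ chainCount d (p+1) k x` of the previous file and the generating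
function of chains, the convolution power `H_z^{*n}` of `H_z = G_z - δ`; here `H_z^{*n}` is set up
as a real function for `0 < z < z_c` and bounded uniformly in `x` by the torus integral
`(2π)^{-d} ∫ |Ĥ_z(k)|^n dk` (Fourier inversion), with `|Ĥ_z| ≤ K Ĉ_λ (K|D̂| + ‖Π_z‖₁)` under the
bootstrap inequalities of Slade's §5.

## What is formalised (namespace `Literature.Probability.RandomPlanarGeometry.SAW.Zd.Graham2010`)

* `hfun d z = H_z = G_z - δ`, `hfun_eq_tsum` (`= Σ_{n≥1} cₙ(x) zⁿ`), `summable_abs_hfun`;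
* `convPow d z n = H_z^{*n}` (`H^{*0} = δ`), `summable_abs_convPow`, `latticeFT_convPow`
  (`= Ĥ_zⁿ`), **`chainCount_mul_pow_le_convPow`** (`chainCount d n k x · z^k ≤ H_z^{*n}(x)`);
* **`convPow_le_of_lintegral_le`** — `H_z^{*n}(y) ≤ B` whenever `∫ ‖Ĥ_z(k)‖ⁿ dk ≤ (2π)^d B`
  (Fourier inversion `integral_cexp_kdot_mul_latticeFT`);
* `norm_latticeFT_hfun_le` — `‖Ĥ_z(k)‖ ≤ K Ĉ_λ(k) (K |D̂(k)| + Σ_x |Π_z(x)|)` for `0 < z < z_c`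
  under `f₁, f₂ ≤ K` ((3.30): `Ĝ_z (1 - z·2Σcos - Π̂_z) = 1`, so `Ĥ_z = Ĝ_z - 1 = Ĝ_z (2dz D̂ + Π̂_z)`);
* `lintegral_enorm_latticeFT_hfun_pow_le` and **`convPow_le`** — with the simple-random-walk
  integral bound `∫ Ĉ_λⁿ ≤ (16ⁿ + 1)(2π)^d` of `GaussianDominationRouteRandomWalk.lean`
  (Heydenreich–van der Hofstad, Prop. 5.5) for `d ≥ 6n + 1`:
  `H_z^{*n}(y) ≤ (16ⁿ + 1)(K(K + ‖Π_z‖₁))ⁿ` uniformly in `y`.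
-/

noncomputable section

open Finset Filter Topology MeasureTheory
open scoped BigOperators ENNReal
open Literature.Probability.LatticeModels Literature.Probability.LatticeModels.SRW
open Literature.Barriers.CriticalPhenomena Literature.Barriers.CriticalPhenomena.SAWLace
open Literature.Barriers.CriticalPhenomena.Slade2006Prop53
open Literature.Probability.RandomPlanarGeometry.LaceExpansion (laceCoeff lacePi)

namespace Literature.Probability.RandomPlanarGeometry.SAW.Zd.Graham2010

variable {d : ℕ}

/-! ### `H_z = G_z - δ` -/

/-- `H_z(x) = G_z(x) - δ_{0,x} = Σ_{n ≥ 1} cₙ(x) zⁿ` (real-valued; used for `0 < z < z_c`).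
[cite: Slade2006LaceExpansion, eq. (4.6)] -/
def hfun (d : ℕ) (z : ℝ) (x : Site d) : ℝ := twoPoint d 1 z x - if x = 0 then 1 else 0

/-- `H_z(x) = Σ_{n ≥ 1} cₙ(x) zⁿ`. [cite: Slade2006LaceExpansion, eq. (4.6)] -/
theorem hfun_eq_tsum {z : ℝ} (hz : 0 < z) (hzc : z < criticalPoint d) (x : Site d) :
    hfun d z x = ∑' n : ℕ, (countAt d (n + 1) x : ℝ) * z ^ (n + 1) := by
  unfold hfun
  rw [twoPoint_one_eq_tsum, (summable_countAt_mul_pow hz hzc x).tsum_eq_zero_add, countAt_zero, pow_zero,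
    mul_one]
  push_cast
  ring

/-- `H_z ≥ 0`. [folklore] -/
theorem hfun_nonneg {z : ℝ} (hz : 0 < z) (hzc : z < criticalPoint d) (x : Site d) : 0 ≤ hfun d z x := by
  rw [hfun_eq_tsum hz hzc]
  exact tsum_nonneg fun n => by positivity

/-- A single term: `c_m(x) z^m ≤ H_z(x)` for `m ≥ 1`. [folklore] -/
theorem countAt_mul_pow_le_hfun {z : ℝ} (hz : 0 < z) (hzc : z < criticalPoint d) {m : ℕ} (hm : 1 ≤ m)
    (x : Site d) : (countAt d m x : ℝ) * z ^ m ≤ hfun d z x := by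
  rw [hfun_eq_tsum hz hzc]
  obtain ⟨n, rfl⟩ : ∃ n, m = n + 1 := ⟨m - 1, by omega⟩
  have hs : Summable fun n : ℕ => (countAt d (n + 1) x : ℝ) * z ^ (n + 1) :=
    (summable_nat_add_iff 1).2 (summable_countAt_mul_pow hz hzc x)
  exact hs.le_tsum n fun j _ => by positivity

/-- A finite block of terms: `Σ_{j<k} c_{k-j}(y) z^{k-j} = Σ_{m=1}^{k} c_m(y) z^m ≤ H_z(y)`. [folklore] -/
theorem sum_range_countAt_mul_pow_le_hfun {z : ℝ} (hz : 0 < z) (hzc : z < criticalPoint d) (k : ℕ)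
    (y : Site d) : ∑ j ∈ Finset.range k, (countAt d (k - j) y : ℝ) * z ^ (k - j) ≤ hfun d z y := by
  rw [hfun_eq_tsum hz hzc]
  have hs : Summable fun n : ℕ => (countAt d (n + 1) y : ℝ) * z ^ (n + 1) :=
    (summable_nat_add_iff 1).2 (summable_countAt_mul_pow hz hzc y)
  calc ∑ j ∈ Finset.range k, (countAt d (k - j) y : ℝ) * z ^ (k - j)
      = ∑ m ∈ Finset.range k, (countAt d (m + 1) y : ℝ) * z ^ (m + 1) := by
        rw [← Finset.sum_range_reflect (fun j => (countAt d (k - j) y : ℝ) * z ^ (k - j)) k]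
        refine Finset.sum_congr rfl fun m hm => ?_
        rw [Finset.mem_range] at hm
        rw [show k - (k - 1 - m) = m + 1 by omega]
    _ ≤ ∑' n : ℕ, (countAt d (n + 1) y : ℝ) * z ^ (n + 1) :=
        hs.sum_le_tsum _ fun n _ => by positivity

/-- `H_z` is absolutely summable (`Σ_x H_z(x) = χ(z) - 1 < ∞` for `z < z_c`). [folklore] -/
theorem summable_abs_hfun {z : ℝ} (hz : 0 < z) (hzc : z < criticalPoint d) :
    Summable fun x : Site d => |hfun d z x| := by
  have h1 : Summable fun x : Site d => |twoPoint d 1 z x| := summable_abs_twoPoint hz hzc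
  have h2 : Summable fun x : Site d => |(if x = 0 then (1 : ℝ) else 0)| := by
    refine summable_of_ne_finset_zero (s := {0}) fun x hx => ?_
    rw [Finset.mem_singleton] at hx
    simp [hx]
  refine (h1.add h2).of_nonneg_of_le (fun x => abs_nonneg _) fun x => ?_
  unfold hfun
  exact abs_sub _ _

/-- `H_z(x) ≤ ‖H_z‖₁`. [folklore] -/
theorem hfun_le_tsum_abs {z : ℝ} (hz : 0 < z) (hzc : z < criticalPoint d) (x : Site d) :
    hfun d z x ≤ ∑' y : Site d, |hfun d z y| :=
  (le_abs_self _).trans ((summable_abs_hfun hz hzc).le_tsum x fun _ _ => abs_nonneg _)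

/-! ### Convolution powers `H_z^{*n}` -/

/-- `convPow d z n = H_z^{*n}` (`H^{*0} = δ`, `H^{*(n+1)}(x) = Σ_v H^{*n}(v) H_z(x - v)`). [folklore] -/
def convPow (d : ℕ) (z : ℝ) : ℕ → Site d → ℝ
  | 0 => fun x => if x = 0 then 1 else 0
  | n + 1 => fun x => ∑' v : Site d, convPow d z n v * hfun d z (x - v)

/-- `H^{*0} = δ`. [folklore] -/
theorem convPow_zero (z : ℝ) (x : Site d) : convPow d z 0 x = if x = 0 then 1 else 0 := rfl

/-- The recursion. [folklore] -/
theorem convPow_succ (z : ℝ) (n : ℕ) (x : Site d) :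
    convPow d z (n + 1) x = ∑' v : Site d, convPow d z n v * hfun d z (x - v) := rfl

/-- `H_z^{*n}` is absolutely summable and nonnegative. [folklore] -/
theorem summable_abs_convPow {z : ℝ} (hz : 0 < z) (hzc : z < criticalPoint d) :
    ∀ n : ℕ, (Summable fun x : Site d => |convPow d z n x|) ∧ ∀ x, 0 ≤ convPow d z n x := by
  intro n
  induction n with
  | zero =>
    refine ⟨summable_of_ne_finset_zero (s := {0}) fun x hx => ?_, fun x => ?_⟩
    · rw [Finset.mem_singleton] at hx
      simp [convPow_zero, hx]
    · rw [convPow_zero]; split_ifs <;> norm_num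
  | succ n ih =>
    refine ⟨?_, fun x => ?_⟩
    · have h := (summable_abs_conv ih.1 (summable_abs_hfun hz hzc)).2
      exact h
    · rw [convPow_succ]
      exact tsum_nonneg fun v => mul_nonneg (ih.2 v) (hfun_nonneg hz hzc _)

/-- The summands of the recursion are summable in `v` (for each `x`). [folklore] -/
theorem summable_convPow_mul_hfun {z : ℝ} (hz : 0 < z) (hzc : z < criticalPoint d) (n : ℕ) (x : Site d) :
    Summable fun v : Site d => convPow d z n v * hfun d z (x - v) := by
  have h := (summable_abs_conv (summable_abs_convPow hz hzc n).1 (summable_abs_hfun hz hzc)).1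
  have h' : Summable fun v : Site d => |convPow d z n v * hfun d z (x - v)| := h.prod_factor x
  exact h'.of_abs

/-- **`(H^{*n})^ = Ĥⁿ`** (convolution theorem). [folklore] -/
theorem latticeFT_convPow {z : ℝ} (hz : 0 < z) (hzc : z < criticalPoint d) (k : Fin d → ℝ) :
    ∀ n : ℕ, latticeFT (convPow d z n) k = latticeFT (hfun d z) k ^ n := by
  intro n
  induction n with
  | zero =>
    rw [pow_zero]
    exact latticeFT_delta k
  | succ n ih =>
    rw [pow_succ, ← ih]
    exact latticeFT_conv (summable_abs_convPow hz hzc n).1 (summable_abs_hfun hz hzc) k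

/-- **Chains are dominated by the convolution power**: `chainCount d n k x · z^k ≤ H_z^{*n}(x)`
(the generating function of `n`-chains of self-avoiding walks of positive lengths is `H_z^{*n}`;
a single coefficient is at most the sum). [folklore] -/
theorem chainCount_mul_pow_le_convPow {z : ℝ} (hz : 0 < z) (hzc : z < criticalPoint d) :
    ∀ (n k : ℕ) (x : Site d), (chainCount d n k x : ℝ) * z ^ k ≤ convPow d z n x := by
  intro n
  induction n with
  | zero =>
    intro k x
    rw [chainCount_zero, convPow_zero]
    by_cases h : k = 0 ∧ x = 0
    · rw [if_pos h, if_pos h.2, h.1]; simp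
    · rw [if_neg h]; simp only [Nat.cast_zero, zero_mul]
      split_ifs <;> norm_num
  | succ n ih =>
    intro k x
    rw [chainCount_succ, convPow_succ]
    have hnn := (summable_abs_convPow hz hzc n).2
    -- summability of the pieces
    have hsm : ∀ j ∈ Finset.range k, Summable fun b : Site d =>
        convPow d z n b * ((countAt d (k - j) (x - b) : ℝ) * z ^ (k - j)) := by
      intro j hj
      rw [Finset.mem_range] at hj
      refine (summable_convPow_mul_hfun hz hzc n x).of_nonneg_of_le (fun b => ?_) fun b => ?_
      · exact mul_nonneg (hnn b) (by positivity)
      · exact mul_le_mul_of_nonneg_left (countAt_mul_pow_le_hfun hz hzc (by omega) _) (hnn b)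
    calc ((∑ j ∈ Finset.range k, ∑ b ∈ box d j, chainCount d n j b * countAt d (k - j) (x - b) : ℕ) : ℝ) * z ^ k
        = ∑ j ∈ Finset.range k, ∑ b ∈ box d j,
            ((chainCount d n j b : ℝ) * z ^ j) * ((countAt d (k - j) (x - b) : ℝ) * z ^ (k - j)) := by
          push_cast
          rw [Finset.sum_mul]
          refine Finset.sum_congr rfl fun j hj => ?_
          rw [Finset.mem_range] at hj
          rw [Finset.sum_mul]
          refine Finset.sum_congr rfl fun b _ => ?_
          rw [show z ^ k = z ^ j * z ^ (k - j) by rw [← pow_add]; congr 1; omega]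
          ring
      _ ≤ ∑ j ∈ Finset.range k, ∑ b ∈ box d j,
            convPow d z n b * ((countAt d (k - j) (x - b) : ℝ) * z ^ (k - j)) := by
          refine Finset.sum_le_sum fun j _ => Finset.sum_le_sum fun b _ => ?_
          exact mul_le_mul_of_nonneg_right (ih j b) (by positivity)
      _ ≤ ∑ j ∈ Finset.range k, ∑' b : Site d,
            convPow d z n b * ((countAt d (k - j) (x - b) : ℝ) * z ^ (k - j)) := by
          refine Finset.sum_le_sum fun j hj => ?_
          exact (hsm j hj).sum_le_tsum _ fun b _ => mul_nonneg (hnn b) (by positivity)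
      _ = ∑' b : Site d, ∑ j ∈ Finset.range k,
            convPow d z n b * ((countAt d (k - j) (x - b) : ℝ) * z ^ (k - j)) :=
          (Summable.tsum_finsetSum hsm).symm
      _ = ∑' b : Site d, convPow d z n b *
            ∑ j ∈ Finset.range k, ((countAt d (k - j) (x - b) : ℝ) * z ^ (k - j)) :=
          tsum_congr fun b => by rw [Finset.mul_sum]
      _ ≤ ∑' b : Site d, convPow d z n b * hfun d z (x - b) := by
          refine Summable.tsum_le_tsum (fun b => ?_) ?_ (summable_convPow_mul_hfun hz hzc n x)
          · exact mul_le_mul_of_nonneg_left (sum_range_countAt_mul_pow_le_hfun hz hzc k _) (hnn b)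
          · exact (summable_sum fun j hj => hsm j hj).congr fun b => by rw [Finset.mul_sum]

/-! ### The uniform bound by Fourier inversion -/

/-- **`H_z^{*n}(y) ≤ B` whenever `∫_{[-π,π]^d} ‖Ĥ_z(k)‖ⁿ dk ≤ (2π)^d B`** (Fourier inversion for the
absolutely summable `H_z^{*n}`, whose transform is `Ĥ_zⁿ`). [folklore] -/
theorem convPow_le_of_lintegral_le {z : ℝ} (hz : 0 < z) (hzc : z < criticalPoint d) (n : ℕ) {B : ℝ}
    (hB : 0 ≤ B)
    (h : ∫⁻ k in cube d, ‖latticeFT (hfun d z) k‖ₑ ^ n ≤ ENNReal.ofReal ((2 * Real.pi) ^ d * B))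
    (y : Site d) : convPow d z n y ≤ B := by
  have hsum := (summable_abs_convPow hz hzc n).1
  have hnn := (summable_abs_convPow hz hzc n).2 y
  have hinv := integral_cexp_kdot_mul_latticeFT hsum y
  have hinv' : ∫ k in cube d, Complex.exp (Complex.I * (kdot k y : ℂ)) * latticeFT (hfun d z) k ^ n =
      ((2 * Real.pi) ^ d : ℂ) * (convPow d z n y : ℂ) := by
    rw [← hinv]
    refine setIntegral_congr_fun (measurableSet_cube d) fun k _ => ?_
    simp only [latticeFT_convPow hz hzc k n]
  have hnorm : ‖((2 * Real.pi) ^ d : ℂ) * (convPow d z n y : ℂ)‖ = (2 * Real.pi) ^ d * convPow d z n y := by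
    rw [norm_mul, Complex.norm_real, Real.norm_eq_abs, abs_of_nonneg hnn,
      show ((2 * Real.pi) ^ d : ℂ) = (((2 * Real.pi) ^ d : ℝ) : ℂ) by push_cast; ring,
      Complex.norm_real, Real.norm_eq_abs, abs_of_nonneg (by positivity)]
  have hle : (2 * Real.pi) ^ d * convPow d z n y ≤ ∫ k in cube d, ‖latticeFT (hfun d z) k‖ ^ n := by
    rw [← hnorm, ← hinv']
    refine (norm_integral_le_integral_norm _).trans (le_of_eq ?_)
    refine setIntegral_congr_fun (measurableSet_cube d) fun k _ => ?_
    rw [norm_mul, norm_cexp_I_mul_kdot, one_mul, norm_pow]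
  have hint : ∫ k in cube d, ‖latticeFT (hfun d z) k‖ ^ n =
      (∫⁻ k in cube d, ‖latticeFT (hfun d z) k‖ₑ ^ n).toReal := by
    have hmeas : AEStronglyMeasurable (fun k : Fin d → ℝ => ‖latticeFT (hfun d z) k‖ ^ n)
        (volume.restrict (cube d)) := by
      have hc : Continuous fun k : Fin d → ℝ => ‖latticeFT (hfun d z) k‖ ^ n :=
        (continuous_latticeFT (summable_abs_hfun hz hzc)).norm.pow n
      exact hc.aestronglyMeasurable
    have hnn' : 0 ≤ᵐ[volume.restrict (cube d)] fun k : Fin d → ℝ => ‖latticeFT (hfun d z) k‖ ^ n :=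
      Filter.Eventually.of_forall fun k => by simp only [Pi.zero_apply]; positivity
    rw [integral_eq_lintegral_of_nonneg_ae hnn' hmeas]
    congr 1
    refine lintegral_congr fun k => ?_
    rw [← ofReal_norm, ENNReal.ofReal_pow (norm_nonneg _)]
  have hfin : (2 * Real.pi) ^ d * convPow d z n y ≤ (2 * Real.pi) ^ d * B := by
    refine hle.trans ?_
    rw [hint]
    exact ENNReal.toReal_le_of_le_ofReal (by positivity) h
  exact le_of_mul_le_mul_left hfin (by positivity)

/-! ### The pointwise bound on `|Ĥ_z|` under the bootstrap inequalities -/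

/-- `Ĥ_z = Ĝ_z - 1`. [folklore] -/
theorem latticeFT_hfun_eq {z : ℝ} (hz : 0 < z) (hzc : z < criticalPoint d) (k : Fin d → ℝ) :
    latticeFT (hfun d z) k = latticeFT (twoPoint d 1 z) k - 1 := by
  have h2 : Summable fun x : Site d => |(if x = 0 then (1 : ℝ) else 0)| := by
    refine summable_of_ne_finset_zero (s := {0}) fun x hx => ?_
    rw [Finset.mem_singleton] at hx
    simp [hx]
  unfold hfun
  rw [latticeFT_sub (summable_abs_twoPoint hz hzc) h2, latticeFT_delta]

/-- **`‖Ĥ_z(k)‖ ≤ K Ĉ_λ(k) (K |D̂(k)| + ‖Π_z‖₁)`** for `0 < z < z_c` under `f₁, f₂ ≤ K`, with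
`λ = λ_z` and `‖Π_z‖₁ = Σ_x |Π_z(x)|`: from (3.30) `Ĝ_z (1 - z·2Σⱼcos kⱼ - Π̂_z) = 1` one has
`Ĥ_z = Ĝ_z - 1 = Ĝ_z (2dz D̂ + Π̂_z)`. [cite: Slade2006LaceExpansion, eq. (3.30) and (5.32)] -/
theorem norm_latticeFT_hfun_le (hd : 1 ≤ d) {z : ℝ} (hz : 0 < z) (hzc : z < criticalPoint d) {K : ℝ}
    (hboot : Boot d K z) (hπ : Summable fun p : ℕ × Site d => |laceCoeff d 1 p.1 p.2| * z ^ p.1)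
    (k : Fin d → ℝ) :
    ‖latticeFT (hfun d z) k‖ ≤
      K * srwGreenFT d (lamOf d z) k * (K * |srwStepFT d k| + ∑' x, |lacePi d 1 z x|) := by
  have hid := latticeFT_twoPoint_mul_eq_one hz hzc hπ k
  set G := latticeFT (twoPoint d 1 z) k with hG
  set P := latticeFT (lacePi d 1 z) k with hP
  set C : ℂ := (((2 * ∑ j, Real.cos (k j) : ℝ)) : ℂ) with hC
  have hH : latticeFT (hfun d z) k = G * ((z : ℂ) * C + P) := by
    rw [latticeFT_hfun_eq hz hzc, ← hG]
    linear_combination hid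
  have hK0 : 0 ≤ K := le_trans (by positivity) hboot.f1
  have hGn : ‖G‖ ≤ K * srwGreenFT d (lamOf d z) k := by
    rw [hG, latticeFT_twoPoint hz hzc, Complex.norm_real, Real.norm_eq_abs]
    exact hboot.f2 k
  have hCn : ‖(z : ℂ) * C‖ ≤ K * |srwStepFT d k| := by
    rw [norm_mul, Complex.norm_real, Real.norm_eq_abs, abs_of_pos hz, hC, Complex.norm_real,
      Real.norm_eq_abs, two_mul_sum_cos_eq hd, abs_mul, abs_of_nonneg (by positivity : (0 : ℝ) ≤ 2 * d)]
    calc z * (2 * d * |srwStepFT d k|) = z * (2 * d) * |srwStepFT d k| := by ring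
      _ ≤ K * |srwStepFT d k| := mul_le_mul_of_nonneg_right hboot.f1 (abs_nonneg _)
  have hPn : ‖P‖ ≤ ∑' x, |lacePi d 1 z x| := norm_latticeFT_le (summable_abs_lacePi hz.le hπ) k
  have hsrw : 0 ≤ srwGreenFT d (lamOf d z) k := by
    obtain ⟨h0, h1⟩ := lamOf_mem (d := d) hz.le hzc
    exact srwGreenFT_nonneg h0 h1.le k
  rw [hH, norm_mul]
  refine mul_le_mul hGn ((norm_add_le _ _).trans (add_le_add hCn hPn)) (norm_nonneg _) (by positivity)

/-! ### The torus integral and the uniform bound on `H_z^{*n}` -/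

/-- `Ĉ_λ = Chat` (the two spellings of the simple-random-walk Green function in `k`-space). [folklore] -/
theorem srwGreenFT_eq_Chat (lam : ℝ) (k : Fin d → ℝ) : srwGreenFT d lam k = Chat d lam k := by
  rw [Chat, one_div]; rfl

/-- **`∫ ‖Ĥ_z‖ⁿ ≤ (K(K + ‖Π_z‖₁))ⁿ (16ⁿ + 1) (2π)^d`** for `d ≥ 6n + 1`, `0 < z < z_c` under
`f₁, f₂ ≤ K` (`‖Ĥ_z‖ ≤ KĈ_λ(K|D̂| + ‖Π_z‖₁) ≤ K(K + ‖Π_z‖₁) Ĉ_λ` and HvdH's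
`∫ Ĉ_λⁿ ≤ (16ⁿ + 1)(2π)^d`, `lintegral_Chat_pow_le`).
[cite: HeydenreichVanDerHofstad2017, Prop. 5.5] -/
theorem lintegral_enorm_latticeFT_hfun_pow_le {n : ℕ} (hd : 6 * n + 1 ≤ d) {z : ℝ} (hz : 0 < z)
    (hzc : z < criticalPoint d) {K : ℝ} (hboot : Boot d K z)
    (hπ : Summable fun p : ℕ × Site d => |laceCoeff d 1 p.1 p.2| * z ^ p.1) :
    ∫⁻ k in cube d, ‖latticeFT (hfun d z) k‖ₑ ^ n ≤
      ENNReal.ofReal ((K * (K + ∑' x, |lacePi d 1 z x|)) ^ n * ((16 ^ n + 1) * (2 * Real.pi) ^ d)) := by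
  have hd1 : 1 ≤ d := le_trans (by omega) hd
  obtain ⟨h0, h1⟩ := lamOf_mem (d := d) hz.le hzc
  have hK0 : 0 ≤ K := le_trans (by positivity) hboot.f1
  set Pabs : ℝ := ∑' x, |lacePi d 1 z x| with hPabs
  have hP0 : 0 ≤ Pabs := tsum_nonneg fun x => abs_nonneg _
  set c : ℝ := (K * (K + Pabs)) ^ n with hc
  -- pointwise: `‖Ĥ‖ₑⁿ ≤ ofReal c * ofReal (Chatⁿ)`
  have hpt : ∀ k : Fin d → ℝ, ‖latticeFT (hfun d z) k‖ₑ ^ n ≤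
      ENNReal.ofReal c * ENNReal.ofReal (Chat d (lamOf d z) k ^ n) := by
    intro k
    have hC0 : 0 ≤ Chat d (lamOf d z) k := Chat_nonneg h0 h1.le k
    have hH := norm_latticeFT_hfun_le hd1 hz hzc hboot hπ k
    rw [srwGreenFT_eq_Chat] at hH
    have hD : |srwStepFT d k| ≤ 1 := abs_srwStepFT_le k
    have hH' : ‖latticeFT (hfun d z) k‖ ≤ (K * (K + Pabs)) * Chat d (lamOf d z) k := by
      calc ‖latticeFT (hfun d z) k‖ ≤ K * Chat d (lamOf d z) k * (K * |srwStepFT d k| + Pabs) := hH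
        _ ≤ K * Chat d (lamOf d z) k * (K * 1 + Pabs) := by gcongr
        _ = (K * (K + Pabs)) * Chat d (lamOf d z) k := by ring
    rw [← ofReal_norm, ← ENNReal.ofReal_pow (norm_nonneg _), ← ENNReal.ofReal_mul (by positivity),
      hc, ← mul_pow]
    exact ENNReal.ofReal_le_ofReal (pow_le_pow_left₀ (norm_nonneg _) hH' n)
  calc ∫⁻ k in cube d, ‖latticeFT (hfun d z) k‖ₑ ^ n
      ≤ ∫⁻ k in cube d, ENNReal.ofReal c * ENNReal.ofReal (Chat d (lamOf d z) k ^ n) := lintegral_mono hpt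
    _ = ENNReal.ofReal c * ∫⁻ k in cube d, ENNReal.ofReal (Chat d (lamOf d z) k ^ n) := by
        rw [lintegral_const_mul _ ((measurable_Chat _).pow_const n).ennreal_ofReal]
    _ ≤ ENNReal.ofReal c * ENNReal.ofReal ((16 ^ n + 1) * (2 * Real.pi) ^ d) := by
        gcongr
        exact lintegral_Chat_pow_le hd h0 h1.le
    _ = _ := by rw [← ENNReal.ofReal_mul (by positivity)]

/-- **The uniform bound on the convolution powers**: for `d ≥ 6n + 1`, `0 < z < z_c` under
`f₁, f₂ ≤ K`: `H_z^{*n}(y) ≤ (16ⁿ + 1) (K(K + ‖Π_z‖₁))ⁿ` for all `y`.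
[cite: HeydenreichVanDerHofstad2017, Prop. 5.5] -/
theorem convPow_le {n : ℕ} (hd : 6 * n + 1 ≤ d) {z : ℝ} (hz : 0 < z) (hzc : z < criticalPoint d)
    {K : ℝ} (hboot : Boot d K z) (hπ : Summable fun p : ℕ × Site d => |laceCoeff d 1 p.1 p.2| * z ^ p.1)
    (y : Site d) :
    convPow d z n y ≤ (16 ^ n + 1) * (K * (K + ∑' x, |lacePi d 1 z x|)) ^ n := by
  have hK0 : 0 ≤ K := le_trans (by positivity) hboot.f1
  have hP0 : 0 ≤ ∑' x, |lacePi d 1 z x| := tsum_nonneg fun x => abs_nonneg _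
  refine convPow_le_of_lintegral_le hz hzc n (by positivity) ?_ y
  refine (lintegral_enorm_latticeFT_hfun_pow_le hd hz hzc hboot hπ).trans (le_of_eq ?_)
  congr 1
  ring

end Literature.Probability.RandomPlanarGeometry.SAW.Zd.Graham2010
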